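import Summits.NavierStokesRegularity.NavierStokesRegularity.Theorems.FilamentSkeletonRssSkeletonJ1RUnstableCurve

/-!
# Route `FilamentSkeletonRss` · crux `SkeletonJ1R` (stmt-NavierStokesRegularity-23610) · registered line `streamline_kantorovich_R`
# — brick K-§3d for stub K `KantorovichClosingL`: THE SPECTRAL ADAPTER — the hypotheses `Π, C` of `exists_unstableCurve` from a right
# eigenvector, a left eigenvector and a numerical-range bound on the left eigenvector's kernel

Hand `ns-filament-21221-p1` (g18), `--supports stmt-NavierStokesRegularity-23610 --as helper`; pure Mathlib (+ the landed
`…SkeletonJ1RUnstableCurve`), route-independent.  Written on the tenure planner's vet (2026-08-29T13:42Z): «(Π) first — it is what lets K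
instantiate the brick at the clause-12 waist block BY NAME».

WHAT.  `exists_unstableCurve` (p723160) asks for a bounded operator `Π` with `Π ξ = 0`, `(A − λ)(1 − Π) = 0` and the growth bound
`‖exp(tA) Π v‖ ≤ C e^{λt} ‖Π v‖` (`t ≥ 0`), `A = Df(p)`.  On a real Hilbert space (e.g. `EuclideanSpace ℝ (Fin 3)`, the waist block) these
follow from ELEMENTARY spectral data of the simple top eigenvalue — no Jordan form, no complexification:
* a right eigenvector `ξ` (`A ξ = λ ξ`) and a left eigenvector `ℓ : E →L[ℝ] ℝ` (`ℓ ∘ A = λ ℓ`) normalised by `ℓ ξ = 1`; then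
  `Π v := v − ℓ(v) ξ` (`Π = 1 − ℓ ⊗ ξ`, `eigenlineProj_*`) is the spectral projection OFF the eigenline: `Π ξ = 0`, `ℓ ∘ Π = 0`,
  `A v − A Πv = λ (v − Πv)`;
* a NUMERICAL-RANGE bound on the invariant complement `ker ℓ`: `⟪A w, w⟫ ≤ β ‖w‖²` for `ℓ w = 0`, with `β ≤ λ` (at the clause-12 block:
  unstable slip slope `λ = w′(0) > 0`; normal block = swirl (skew, numerical range `0`) + strain of negative trace `⇒ β < 0 < λ` up to the
  `O(Rb)` coupling); then `ker ℓ` is `exp(tA)`-invariant (`apply_exp_smul_eq_zero`: `e^{−λt} ℓ(exp(tA)w)` has zero derivative) and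
  `‖exp(tA) w‖ ≤ e^{βt} ‖w‖` there (`norm_exp_smul_apply_le_of_inner_le`: `e^{−2βt}‖exp(tA)w‖²` is non-increasing), so `C = 1`.
PACKAGED: `exists_unstableCurve_of_leftEigenvector` and `exists_unstableCurve_trajectory_of_leftEigenvector` = p723160's two theorems with
the hypotheses `(ξ, ℓ, λ, β)` in place of `(Π, C)`.

HONEST FRAMING.  Linear-algebra/calculus bookkeeping for a sub-brick of the OPEN stub K of the ∃-side of a HYPOTHETICAL filament-type
rotating-self-similar blow-up skeleton (MODEL rung, negative side); stub K, the crux 23610 and its heart stay OPEN; nothing here is a claim about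
Navier–Stokes regularity or blow-up.  References: Kato, *Perturbation Theory for Linear Operators* (1966) I §5.3 (eigenprojection of a simple
eigenvalue `P = ⟨·, ℓ⟩ ξ`); Khalil, *Nonlinear Systems* (2002) §4.3 (exponential bounds from a quadratic Lyapunov function).
-/

set_option linter.dupNamespace false -- `NavierStokesRegularity.NavierStokesRegularity` path/namespace repetition is the tree convention

noncomputable section

namespace Summit.NavierStokesRegularity.NavierStokesRegularity.Theorems.SkeletonJ1RUnstableCurve

open Set Function Filter Metric NormedSpace
open scoped Topology InnerProductSpace

section Projection

variable {E : Type*} [NormedAddCommGroup E] [NormedSpace ℝ E]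

/-! ## §1 The projection off the eigenline `Π = 1 − ℓ ⊗ ξ` -/

/-- `Π v = v − ℓ(v) ξ` for `Π = 1 − ℓ.smulRight ξ`. [folklore] -/
theorem eigenlineProj_apply (ℓ : E →L[ℝ] ℝ) (ξ v : E) :
    ((1 : E →L[ℝ] E) - ℓ.smulRight ξ) v = v - ℓ v • ξ := by
  simp [ContinuousLinearMap.smulRight_apply]

/-- `Π ξ = 0` when `ℓ ξ = 1`. [folklore] -/
theorem eigenlineProj_apply_self {ℓ : E →L[ℝ] ℝ} {ξ : E} (hℓξ : ℓ ξ = 1) :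
    ((1 : E →L[ℝ] E) - ℓ.smulRight ξ) ξ = 0 := by
  rw [eigenlineProj_apply, hℓξ, one_smul, sub_self]

/-- `ℓ (Π v) = 0` when `ℓ ξ = 1`: `Π` maps into `ker ℓ`. [folklore] -/
theorem apply_eigenlineProj {ℓ : E →L[ℝ] ℝ} {ξ : E} (hℓξ : ℓ ξ = 1) (v : E) :
    ℓ (((1 : E →L[ℝ] E) - ℓ.smulRight ξ) v) = 0 := by
  rw [eigenlineProj_apply, map_sub, map_smul, hℓξ, smul_eq_mul, mul_one, sub_self]

/-- `(A − λ)(1 − Π) = 0`: `A v − A (Π v) = λ (v − Π v)` when `A ξ = λ ξ`. [folklore] -/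
theorem sub_apply_eigenlineProj {A : E →L[ℝ] E} {ℓ : E →L[ℝ] ℝ} {ξ : E} {lam : ℝ} (hAξ : A ξ = lam • ξ) (v : E) :
    A v - A (((1 : E →L[ℝ] E) - ℓ.smulRight ξ) v) = lam • (v - ((1 : E →L[ℝ] E) - ℓ.smulRight ξ) v) := by
  rw [eigenlineProj_apply, map_sub, map_smul, hAξ, sub_sub_cancel, sub_sub_cancel, smul_comm]

end Projection

section Growth

variable {E : Type*} [NormedAddCommGroup E] [InnerProductSpace ℝ E] [CompleteSpace E]

/-! ## §2 Invariance of `ker ℓ` and growth from the numerical range -/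

/-- `t ↦ exp(tA) w` solves `x′ = A x`. [folklore] -/
theorem hasDerivAt_exp_smul_apply' (A : E →L[ℝ] E) (w : E) (t : ℝ) :
    HasDerivAt (fun τ : ℝ => exp (τ • A) w) (A (exp (t • A) w)) t := by
  have h := (hasDerivAt_exp_smul_const' (𝕂 := ℝ) A t).clm_apply (hasDerivAt_const t w)
  simpa using h

/-- The kernel of a left eigenvector is invariant under the linear flow: if `ℓ ∘ A = λ ℓ` and `ℓ w = 0` then `ℓ (exp(tA) w) = 0` for all `t`
(`e^{−λt} ℓ(exp(tA) w)` has zero derivative). [folklore] -/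
theorem apply_exp_smul_eq_zero {A : E →L[ℝ] E} {ℓ : E →L[ℝ] ℝ} {lam : ℝ} (hℓA : ∀ v, ℓ (A v) = lam * ℓ v)
    {w : E} (hw : ℓ w = 0) (t : ℝ) : ℓ (exp (t • A) w) = 0 := by
  set ψ : ℝ → ℝ := fun τ => Real.exp (-(lam * τ)) * ℓ (exp (τ • A) w) with hψ
  have hd : ∀ τ, HasDerivAt ψ 0 τ := by
    intro τ
    have h1 : HasDerivAt (fun τ => Real.exp (-(lam * τ))) (Real.exp (-(lam * τ)) * (-lam)) τ := by
      simpa using (((hasDerivAt_id τ).const_mul lam).neg).exp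
    have h2 : HasDerivAt (fun τ => ℓ (exp (τ • A) w)) (ℓ (A (exp (τ • A) w))) τ :=
      ℓ.hasFDerivAt.comp_hasDerivAt τ (hasDerivAt_exp_smul_apply' A w τ)
    have h := h1.mul h2
    refine h.congr_deriv ?_
    rw [hℓA]; ring
  have hc := is_const_of_deriv_eq_zero (fun τ => (hd τ).differentiableAt) (fun τ => (hd τ).deriv) t 0
  have h0 : ψ 0 = 0 := by simp [hψ, hw]
  have ht : ψ t = 0 := by rw [hc, h0]
  have he : Real.exp (-(lam * t)) ≠ 0 := (Real.exp_pos _).ne'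
  simpa [hψ, he] using ht

/-- **Growth on the invariant complement from the numerical range.**  If `ℓ ∘ A = λ ℓ` and `⟪A w, w⟫ ≤ β ‖w‖²` on `ker ℓ`, then
`‖exp(tA) w‖ ≤ e^{βt} ‖w‖` for `w ∈ ker ℓ`, `t ≥ 0` (`e^{−2βt} ‖exp(tA) w‖²` is non-increasing).
[cite: Khalil2002, Theorem 4.6 (proof)] -/
theorem norm_exp_smul_apply_le_of_inner_le {A : E →L[ℝ] E} {ℓ : E →L[ℝ] ℝ} {lam β : ℝ}
    (hℓA : ∀ v, ℓ (A v) = lam * ℓ v) (hnum : ∀ w, ℓ w = 0 → ⟪A w, w⟫_ℝ ≤ β * ‖w‖ ^ 2)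
    {w : E} (hw : ℓ w = 0) {t : ℝ} (ht : 0 ≤ t) : ‖exp (t • A) w‖ ≤ Real.exp (β * t) * ‖w‖ := by
  set φ : ℝ → E := fun τ => exp (τ • A) w with hφ
  have hφd : ∀ τ, HasDerivAt φ (A (φ τ)) τ := fun τ => hasDerivAt_exp_smul_apply' A w τ
  have hφker : ∀ τ, ℓ (φ τ) = 0 := fun τ => apply_exp_smul_eq_zero hℓA hw τ
  set g : ℝ → ℝ := fun τ => Real.exp (-(2 * β * τ)) * ⟪φ τ, φ τ⟫_ℝ with hg
  have hgd : ∀ τ, HasDerivAt g (Real.exp (-(2 * β * τ)) * (2 * (⟪A (φ τ), φ τ⟫_ℝ - β * ‖φ τ‖ ^ 2))) τ := by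
    intro τ
    have h1 : HasDerivAt (fun τ => Real.exp (-(2 * β * τ))) (Real.exp (-(2 * β * τ)) * (-(2 * β))) τ := by
      simpa using (((hasDerivAt_id τ).const_mul (2 * β)).neg).exp
    have h2 : HasDerivAt (fun τ => ⟪φ τ, φ τ⟫_ℝ) (⟪φ τ, A (φ τ)⟫_ℝ + ⟪A (φ τ), φ τ⟫_ℝ) τ := (hφd τ).inner ℝ (hφd τ)
    have h := h1.mul h2
    refine h.congr_deriv ?_
    rw [real_inner_comm (A (φ τ)) (φ τ), real_inner_self_eq_norm_sq]
    ring
  have hanti : AntitoneOn g (Ici 0) := by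
    refine antitoneOn_of_deriv_nonpos (convex_Ici 0) (fun τ _ => (hgd τ).continuousAt.continuousWithinAt)
      (fun τ _ => (hgd τ).differentiableAt.differentiableWithinAt) fun τ _ => ?_
    rw [(hgd τ).deriv]
    have h1 : ⟪A (φ τ), φ τ⟫_ℝ - β * ‖φ τ‖ ^ 2 ≤ 0 := by linarith [hnum _ (hφker τ)]
    exact mul_nonpos_of_nonneg_of_nonpos (Real.exp_nonneg _) (by linarith)
  have hgt : g t ≤ g 0 := hanti (mem_Ici.2 le_rfl) (mem_Ici.2 ht) ht
  have hg0 : g 0 = ‖w‖ ^ 2 := by simp [hg, hφ]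
  have hsq : ‖φ t‖ ^ 2 ≤ (Real.exp (β * t) * ‖w‖) ^ 2 := by
    have he : 0 < Real.exp (-(2 * β * t)) := Real.exp_pos _
    have h1 : Real.exp (-(2 * β * t)) * ‖φ t‖ ^ 2 ≤ ‖w‖ ^ 2 := by
      have := hgt; rw [hg0] at this; simpa [hg, real_inner_self_eq_norm_sq] using this
    have h2 : (Real.exp (β * t)) ^ 2 * Real.exp (-(2 * β * t)) = 1 := by
      rw [sq, ← Real.exp_add, ← Real.exp_add, show β * t + β * t + -(2 * β * t) = 0 by ring, Real.exp_zero]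
    calc ‖φ t‖ ^ 2 = (Real.exp (β * t)) ^ 2 * (Real.exp (-(2 * β * t)) * ‖φ t‖ ^ 2) := by
          rw [← mul_assoc, h2, one_mul]
      _ ≤ (Real.exp (β * t)) ^ 2 * ‖w‖ ^ 2 := mul_le_mul_of_nonneg_left h1 (sq_nonneg _)
      _ = (Real.exp (β * t) * ‖w‖) ^ 2 := by ring
  exact (pow_le_pow_iff_left₀ (norm_nonneg _) (by positivity) two_ne_zero).1 hsq

/-- The three hypotheses of `exists_unstableCurve` from `(ξ, ℓ, λ, β)`: with `Π = 1 − ℓ ⊗ ξ`, `Π ξ = 0`, `A v − A Πv = λ(v − Πv)`, and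
`‖exp(tA) Πv‖ ≤ 1 · e^{λt} ‖Πv‖` for `t ≥ 0` (from `β ≤ λ`). [folklore] -/
theorem unstableCurve_hypotheses_of_leftEigenvector {A : E →L[ℝ] E} {ℓ : E →L[ℝ] ℝ} {ξ : E} {lam β : ℝ}
    (hβ : β ≤ lam) (hAξ : A ξ = lam • ξ) (hℓA : ∀ v, ℓ (A v) = lam * ℓ v) (hℓξ : ℓ ξ = 1)
    (hnum : ∀ w, ℓ w = 0 → ⟪A w, w⟫_ℝ ≤ β * ‖w‖ ^ 2) :
    ((1 : E →L[ℝ] E) - ℓ.smulRight ξ) ξ = 0 ∧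
    (∀ v, A v - A (((1 : E →L[ℝ] E) - ℓ.smulRight ξ) v) = lam • (v - ((1 : E →L[ℝ] E) - ℓ.smulRight ξ) v)) ∧
    (∀ t : ℝ, 0 ≤ t → ∀ v : E, ‖exp (t • A) (((1 : E →L[ℝ] E) - ℓ.smulRight ξ) v)‖
      ≤ 1 * Real.exp (lam * t) * ‖((1 : E →L[ℝ] E) - ℓ.smulRight ξ) v‖) := by
  refine ⟨eigenlineProj_apply_self hℓξ, sub_apply_eigenlineProj hAξ, fun t ht v => ?_⟩
  have h := norm_exp_smul_apply_le_of_inner_le hℓA hnum (apply_eigenlineProj hℓξ v) ht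
  rw [one_mul]
  exact h.trans (mul_le_mul_of_nonneg_right (Real.exp_le_exp.2 (mul_le_mul_of_nonneg_right hβ ht)) (norm_nonneg _))

/-! ## §3 The unstable curve from the eigen-data of the simple top eigenvalue -/

/-- **THE `C¹` UNSTABLE CURVE FROM `(ξ, ℓ, λ, β)`.**  `exists_unstableCurve` with the spectral hypotheses discharged by a right eigenvector
`ξ`, a left eigenvector `ℓ` (`ℓ ξ = 1`) of `A = Df(p)` for `λ > 0`, and the numerical-range bound `⟪A w, w⟫ ≤ β‖w‖²` on `ker ℓ`, `β ≤ λ`: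
for every `R > 0` there are `δ > 0`, `C₁ ≥ 0` and `P, P′` with `P(0) = p`, `P′(0) = ξ`, `HasDerivAt P (P′ s) s`, `P′` continuous,
`λ s · P′(s) = f(P(s))` on `(−δ, δ)`, `‖P(s) − p − sξ‖ ≤ min (R|s|) (C₁ s²)`, `‖P′(s) − ξ‖ ≤ C₁|s|`, `P(s) ∈ B(p, ρ₀)`.
[cite: CoddingtonLevinson1955, Ch. 13 Thm 4.1; parameterization form, Cabré–Fontich–de la Llave 2003 Thm 1.1] -/
theorem exists_unstableCurve_of_leftEigenvector {f : E → E} {f' : E → E →L[ℝ] E} {ℓ : E →L[ℝ] ℝ} {p ξ : E}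
    {lam β ω ρ₀ R : ℝ} (hlam : 0 < lam) (hβ : β ≤ lam) (hω : 0 ≤ ω) (hρ₀ : 0 < ρ₀) (hR : 0 < R)
    (hf0 : f p = 0) (hfd : ∀ y ∈ ball p ρ₀, HasFDerivAt f (f' y) y)
    (hlip : ∀ y ∈ ball p ρ₀, ‖f' y - f' p‖ ≤ ω * ‖y - p‖)
    (hAξ : f' p ξ = lam • ξ) (hℓA : ∀ v, ℓ (f' p v) = lam * ℓ v) (hℓξ : ℓ ξ = 1)
    (hnum : ∀ w, ℓ w = 0 → ⟪f' p w, w⟫_ℝ ≤ β * ‖w‖ ^ 2) :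
    ∃ δ C₁ : ℝ, ∃ P P' : ℝ → E, 0 < δ ∧ 0 ≤ C₁ ∧ P 0 = p ∧ P' 0 = ξ ∧
      (∀ s ∈ Ioo (-δ) δ, HasDerivAt P (P' s) s) ∧ ContinuousOn P' (Ioo (-δ) δ) ∧
      (∀ s ∈ Ioo (-δ) δ, (lam * s) • P' s = f (P s)) ∧
      (∀ s ∈ Ioo (-δ) δ, ‖P s - p - s • ξ‖ ≤ R * |s|) ∧
      (∀ s ∈ Ioo (-δ) δ, ‖P s - p - s • ξ‖ ≤ C₁ * s ^ 2) ∧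
      (∀ s ∈ Ioo (-δ) δ, ‖P' s - ξ‖ ≤ C₁ * |s|) ∧
      (∀ s ∈ Ioo (-δ) δ, P s ∈ ball p ρ₀) := by
  obtain ⟨h1, h2, h3⟩ := unstableCurve_hypotheses_of_leftEigenvector hβ hAξ hℓA hℓξ hnum
  exact exists_unstableCurve (Pr := (1 : E →L[ℝ] E) - ℓ.smulRight ξ) (C := 1) hlam hω hρ₀ hR hf0 hfd hlip h1 h2 h3

/-- **THE UNSTABLE STREAMLINE FROM `(ξ, ℓ, λ, β)`.**  `exists_unstableCurve_trajectory` with the spectral hypotheses discharged as in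
`exists_unstableCurve_of_leftEigenvector`: there are `δ > 0` and `P` with `P(0) = p`, `P′(0) = ξ`, `P((−δ,δ)) ⊆ B(p, ρ₀)`, such that for
every `s₀ ∈ (−δ, δ)` the curve `t ↦ P(s₀ e^{λt})` solves `x′ = f(x)` for `t ≤ 0` and tends to `p` as `t → −∞`.
[cite: KaliesKepleyJames2017, §3 Lemma 3.1] -/
theorem exists_unstableCurve_trajectory_of_leftEigenvector {f : E → E} {f' : E → E →L[ℝ] E} {ℓ : E →L[ℝ] ℝ} {p ξ : E}
    {lam β ω ρ₀ : ℝ} (hlam : 0 < lam) (hβ : β ≤ lam) (hω : 0 ≤ ω) (hρ₀ : 0 < ρ₀)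
    (hf0 : f p = 0) (hfd : ∀ y ∈ ball p ρ₀, HasFDerivAt f (f' y) y)
    (hlip : ∀ y ∈ ball p ρ₀, ‖f' y - f' p‖ ≤ ω * ‖y - p‖)
    (hAξ : f' p ξ = lam • ξ) (hℓA : ∀ v, ℓ (f' p v) = lam * ℓ v) (hℓξ : ℓ ξ = 1)
    (hnum : ∀ w, ℓ w = 0 → ⟪f' p w, w⟫_ℝ ≤ β * ‖w‖ ^ 2) :
    ∃ δ : ℝ, ∃ P : ℝ → E, 0 < δ ∧ P 0 = p ∧ HasDerivAt P ξ 0 ∧ (∀ s ∈ Ioo (-δ) δ, P s ∈ ball p ρ₀) ∧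
      ∀ s₀ ∈ Ioo (-δ) δ,
        (∀ t : ℝ, t ≤ 0 → HasDerivAt (fun τ => P (s₀ * Real.exp (lam * τ))) (f (P (s₀ * Real.exp (lam * t)))) t) ∧
        Tendsto (fun t => P (s₀ * Real.exp (lam * t))) atBot (𝓝 p) := by
  obtain ⟨h1, h2, h3⟩ := unstableCurve_hypotheses_of_leftEigenvector hβ hAξ hℓA hℓξ hnum
  exact exists_unstableCurve_trajectory (Pr := (1 : E →L[ℝ] E) - ℓ.smulRight ξ) (C := 1) hlam hω hρ₀ hf0 hfd hlip h1 h2 h3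

end Growth

end Summit.NavierStokesRegularity.NavierStokesRegularity.Theorems.SkeletonJ1RUnstableCurve

end
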